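import Summits.QuantumFields.BalabanUV.T4Continuum.Support.U3PolymerDictionary
import Summits.QuantumFields.BalabanUV.T4Continuum.Support.B13KPStepOfRecord

/-!
# U3 substrate — the polymer dictionary ON THE OBJECTS OF RECORD: NE9's new-term functional at an activity READING NE5's
# `act` slot of record IS NE5's Kotecký–Preiss-form step output of record, and NE5's run-B ∕ run-A functionals of record are
# real parts of NE9-shaped new terms (v1.1 DOCFIX: NE5-internal identities — NOT the NE9 instantiation, whose background slot
# must be coupling-independent; see §2 and `U3PolymerDictionaryNE9Face`)

Cell `pub-balaban`, SUBSTRATE cell seat `b2b-balaban-substrate-p2` ([dict] identification layer ∕ «the U3 one-step cluster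
representation typed ONCE for NE5 ∕ NE7 ∕ NE9», T4-DAG carver call Q-NE9-O1); second file of the dictionary (first:
`Support/U3PolymerDictionary`, the polymer geometries; here: the activities OF RECORD).  Summits-side bookkeeping; the imported
modules are used BY NAME and not edited.

HONEST FRAMING (T4-DAG p. 1).  Rung (B)+1 of the FINITE-VOLUME T⁴ continuum programme — NOT infinite volume, NOT a mass gap, NOT
the Clay problem, NOT a proof of NE5 or NE9 (neither is PRINTED in [Balaban1987RG1]–[Balaban1989LargeFieldII]).  HONEST DEPENDENCY
(cell line, verbatim): continuum YM on T⁴ ⇐ BetaPertH ∧ nine spine estimates (0/9 proved); BetaPertH ⇐ (D1) ∧ (D4) ∧ CAP+tail;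
G-an2-4 gates asym, D1 and NE2/3/4.  DICTIONARY only: 0 estimate, no `def … : Prop`, nothing printed is asserted.

WHAT THIS FILE DOES.  Row NE5's model of record keeps ONE analytic activity slot, `S.act` of `B13StepOfRecord.Slots R E IOp Hist`
(the (2.14)-terms of a polymer with an inner label, read at an operator datum `o : OpDatum E` and a history table `h : Hist`); its
Kotecký–Preiss-form step output of record is `(B13KPStepOfRecord.kpStep S E₀ cB).Out k o h X = Σ_{K ∈ clus X} Φᵀ(K;
B13OutKPForm.activity (b13InnerData R) S.act k o h)` (route P2 gen 18, R-IDENT part C: equal to the TR output of record on the convergence window,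
`B13KPStepOfRecord.outB_KP_eq_outB`).  Row NE9's END faces on the same carriers take an abstract activity
`act : ℕ → ℝ → Bg → Pot → (cubeChart R).geom.P → ℂ` and the new term `ClusterGeom.newTerm act k s U X Q` ([II] (2.13) with the
tables `Q` explicit — O-NE9-1).  READING NE9's abstract background slot `Bg` as NE5's operator datum `OpDatum E` and NE9's
table space `Pot` as NE5's history space `Hist`:
* §1 **`newTerm_eq_kpStep_Out`**: for an NE9 activity `act` READING the slots on footprints (displayed hypothesis
  `hact : act k s o h (footprint Z) = activity … S.act k o h Z`; the canonical inhabitant is the zero-extended lift of the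
  companion `U3PolymerDictionaryLift`), `(cubeChart R).geom.newTerm act k s o X h = (kpStep S E₀ cB).Out k o h X` — THE `act`
  SLOT TYPED ONCE SERVES BOTH ROWS, on the objects of record;
* §2 **`outB_KP_eq_re_newTerm`** ∕ **`outA_KP_eq_re_newTerm`**: NE5's run-B ∕ run-A functionals of record (`B13KPStepOfRecord.outB_KP ∕
  outA_KP`, the causal recursion) ARE the real parts of NE9-SHAPED new terms read at NE5's own input points (operator datum `opB g U k`,
  inserted table `insB g U k (tableB outB_KP g U)`), for every last coupling `s`.  **v1.1 DOCFIX (NE9 owner's shape review OBJ-NE9-g28-1,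
  XREAD F-ne9leaf02g5-1): these are NE5-INTERNAL IDENTITIES, NOT the NE9 instantiation of `hrepr`.**  NE9's END of record requires the
  BACKGROUND slot of `act` to be coupling-INDEPENDENT and every `g₀…g_{k−1}` dependence to be TABLE-borne; here the «background» argument
  is the operator datum `opB g U k`, which MOVES WITH `g` through the potential species `potQ ∕ potR` (Lemma 2 (1.41)–(1.43) data built from
  the history-dependent action), so §2 does NOT inhabit NE9's `hrepr` at a fixed background (kernel witness: the owner's
  `U3PolymerDictionaryNE9Face.not_ne9_of_datum_jump`, p218863).  The NE9 face needs the DATA FACTORISATION of record (MAP v0.3 line D-6: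
  `opB g U (k+1) = oRec k (g k) U (tableB EB g U)`, `insB … = iRec k (g k) U (tableB EB g U)`) and `act := U3PolymerDictionaryNE9Face.actNE9 S
  oRec iRec`; §1 (`newTerm_eq_kpStep_Out`) is the junction both use;
* §3 `outB_eq_re_newTerm` ∕ `outA_eq_re_newTerm`: the same for the TR functionals of record `B13StepOfRecord.outB ∕ outA` on a
  window carrying R-IDENT part C's two convergence binders (BY NAME, displayed).
Nothing here discharges an analytic leaf of either row: `S.act` is the rows' common NAMED PARAMETER (NODE O, constructed by nobody
yet); the file only removes the second copy of it.  Spine PROVED 0∕9 unchanged.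

References (KIND ∕ locus only): [Balaban1988RG2Cluster] (2.11)–(2.14) pp. 14–15; [KoteckyPreiss1986] (3).
-/

noncomputable section

open scoped BigOperators

namespace Summit.QuantumFields.BalabanUV.T4Continuum.U3PolymerDictionaryRecord

open Literature.Probability.LatticeModels (truncatedWeight)
open Literature.MathematicalPhysics.QuantumFieldTheory.Balaban1983to89
open Literature.MathematicalPhysics.QuantumFieldTheory.Balaban1983to89.T4OutputRate (Carriers Functional)
open Literature.MathematicalPhysics.QuantumFieldTheory.Balaban1983to89.T4InputCauchyRateData (StepModel tableA tableB)
open Literature.MathematicalPhysics.QuantumFieldTheory.Balaban1983to89.T4ActivityLipschitz (clusterSum)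
open Literature.MathematicalPhysics.QuantumFieldTheory.Balaban1983to89.T4HistoryLipschitzActivity (ClusterGeom)
open Literature.MathematicalPhysics.QuantumFieldTheory.Balaban1983to89.T4HistoryLipschitzCubeGeometry (CubeChart CubeInc)
open Summit.QuantumFields.BalabanUV.T4Continuum.B13Carriers (TwoRuns)
open Summit.QuantumFields.BalabanUV.T4Continuum.B13DomainGeometryTR (SCube SAdj footprint domainGeometry)
open Summit.QuantumFields.BalabanUV.T4Continuum.B13CarriersCubeChart (cubeChart)
open Summit.QuantumFields.BalabanUV.T4Continuum.B13StepTermSocket (touchInc)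
open Summit.QuantumFields.BalabanUV.T4Continuum.B13InnerData (b13InnerData Bnd)
open Summit.QuantumFields.BalabanUV.T4Continuum.B13OpDatum (OpDatum)
open Summit.QuantumFields.BalabanUV.T4Continuum.B13StepOfRecord (Slots step outA outB assembly)
open Summit.QuantumFields.BalabanUV.T4Continuum.B13OutKPForm (activity)
open Summit.QuantumFields.BalabanUV.T4Continuum.B13OutKPFormRecord (LevelSummable ClusAbsConv)
open Summit.QuantumFields.BalabanUV.T4Continuum.B13KPStepOfRecord
  (kpStep kpStep_Out outB_KP outA_KP inputB_KP inputA_KP representsB_kp representsA_kp outB_KP_eq_outB outA_KP_eq_outA)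
open Summit.QuantumFields.BalabanUV.T4Continuum.U3PolymerDictionary

variable {G : Type} [GaugeGroup G] {R : TwoRuns G} {E : Type} {IOp Hist : Type*} [NormedAddCommGroup Hist] [NormedSpace ℂ Hist]
  (S : Slots R E IOp Hist) (E₀ cB : ℝ)

/-! ## §1 NE9's new term at an activity reading NE5's slot of record = NE5's KP-form step output of record -/

/- READING HYPOTHESIS used below (displayed in every theorem, no `def … : Prop` minted): with NE9's background slot read as
NE5's operator datum and NE9's tables as NE5's histories, the NE9 activity `act` READS NE5's `act` slot of record on footprints,
`hact : ∀ k s o h Z, act k s o h (footprint Z) = activity (b13InnerData R) S.act k o h Z` (the value off the footprints is free: it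
never enters a (2.13) sum, `U3PolymerDictionary.vol_cubeChart_eq`); the companion `U3PolymerDictionaryLift` constructs the
canonical inhabitant (the zero-extended lift). -/

variable {S}

/-- [folklore] **THE `act` SLOT TYPED ONCE SERVES BOTH ROWS (objects of record).**  For an NE9 activity reading NE5's slots,
NE9's new term on the geometry of record `(cubeChart R).geom` at `(k, s, o, X, h)` IS NE5's Kotecký–Preiss-form step output of
record `(kpStep S E₀ cB).Out k o h X` — for every last coupling `s`. -/
theorem newTerm_eq_kpStep_Out {act : ℕ → ℝ → OpDatum E → Hist → Finset (SCube R) → ℂ}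
    (hact : ∀ k s o h Z, act k s o h (footprint Z) = activity (b13InnerData R) S.act k o h Z)
    (k : ℕ) (s : ℝ) (o : OpDatum E) (h : Hist) (X : R.carriers.Dom) :
    (cubeChart R).geom.newTerm act k s o X h = (kpStep S E₀ cB).Out k o h X := by
  rw [newTerm_cubeChart_eq_of_reads (act₅ := fun k s o h => activity (b13InnerData R) S.act k o h)
      (fun k s o h Z => hact k s o h Z), kpStep_Out]
  unfold clusterSum
  exact Finset.sum_congr rfl fun K _ => (truncatedWeight_inc_eq_touchInc _ K).symm

/-! ## §2 NE5's functionals of record are real parts of NE9 new terms (NE9's `hrepr` shape, explicit part zero) -/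

/-- [folklore] **RUN B's FUNCTIONAL OF RECORD AS AN NE9-SHAPED NEW TERM** (an NE5-internal identity): for an activity reading the slots,
`outB_KP S E₀ cB g U X = ((cubeChart R).geom.newTerm act (scale X) s (opB g U (scale X)) X (insB g U (scale X) (tableB outB_KP g U))).re`.
v1.1 DOCFIX: this is NOT NE9's `hrepr` at a fixed background — the operator datum `opB g U k` moves with the coupling history (see the module
docstring; `U3PolymerDictionaryNE9Face` for the NE9 face under the data factorisation D-6). -/
theorem outB_KP_eq_re_newTerm {act : ℕ → ℝ → OpDatum E → Hist → Finset (SCube R) → ℂ}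
    (hact : ∀ k s o h Z, act k s o h (footprint Z) = activity (b13InnerData R) S.act k o h Z)
    (s : ℝ) (g : ℕ → ℝ) (U : R.carriers.BgB) (X : R.carriers.Dom) :
    outB_KP S E₀ cB g U X =
      ((cubeChart R).geom.newTerm act (R.carriers.scale X) s ((step S E₀ cB).opB g U (R.carriers.scale X)) X
        ((step S E₀ cB).insB g U (R.carriers.scale X) (tableB (outB_KP S E₀ cB) g U))).re := by
  rw [newTerm_eq_kpStep_Out E₀ cB hact, representsB_kp S E₀ cB Set.univ g (Set.mem_univ g) U X]
  rfl

/-- [folklore] **RUN A's FUNCTIONAL OF RECORD AS AN NE9-SHAPED NEW TERM** (an NE5-internal identity; at transported backgrounds, under the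
holder's transport reading on every coupling sequence; v1.1 DOCFIX as for run B). -/
theorem outA_KP_eq_re_newTerm {act : ℕ → ℝ → OpDatum E → Hist → Finset (SCube R) → ℂ}
    (hact : ∀ k s o h Z, act k s o h (footprint Z) = activity (b13InnerData R) S.act k o h Z)
    (hT : (assembly S).TransportReads Set.univ) (s : ℝ) (g : ℕ → ℝ) (U : R.carriers.BgB) (X : R.carriers.Dom) :
    outA_KP S E₀ cB g (R.carriers.transport U) X =
      ((cubeChart R).geom.newTerm act (R.carriers.scale X) s ((step S E₀ cB).opA g U (R.carriers.scale X)) X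
        ((step S E₀ cB).insA g U (R.carriers.scale X) (tableA (outA_KP S E₀ cB) g U))).re := by
  rw [newTerm_eq_kpStep_Out E₀ cB hact, representsA_kp S E₀ cB hT g (Set.mem_univ g) U X]
  rfl

/-! ## §3 The TR functionals of record on the convergence window -/

/-- [folklore] **THE TR RUN-B FUNCTIONAL OF RECORD `B13StepOfRecord.outB` AS AN NE9 NEW TERM** on a window carrying R-IDENT part C's
two convergence binders at the KP recursion's input points (`LevelSummable`, `ClusAbsConv`, BY NAME). -/
theorem outB_eq_re_newTerm {act : ℕ → ℝ → OpDatum E → Hist → Finset (SCube R) → ℂ}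
    (hact : ∀ k s o h Z, act k s o h (footprint Z) = activity (b13InnerData R) S.act k o h Z)
    {W : Set (ℕ → ℝ)}
    (hsum : ∀ g ∈ W, ∀ (U : R.carriers.BgB) (X : R.carriers.Dom), LevelSummable S X (inputB_KP S E₀ cB g U X))
    (hK : ∀ g ∈ W, ∀ (U : R.carriers.BgB) (X : R.carriers.Dom), ClusAbsConv S X (inputB_KP S E₀ cB g U X))
    (s : ℝ) {g : ℕ → ℝ} (hg : g ∈ W) (U : R.carriers.BgB) (X : R.carriers.Dom) :
    outB S E₀ cB g U X =
      ((cubeChart R).geom.newTerm act (R.carriers.scale X) s ((step S E₀ cB).opB g U (R.carriers.scale X)) X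
        ((step S E₀ cB).insB g U (R.carriers.scale X) (tableB (outB_KP S E₀ cB) g U))).re := by
  rw [← outB_KP_eq_outB S E₀ cB hsum hK hg U X]
  exact outB_KP_eq_re_newTerm E₀ cB hact s g U X

/-- [folklore] **THE TR RUN-A FUNCTIONAL OF RECORD `B13StepOfRecord.outA` AS AN NE9 NEW TERM** (transported backgrounds; transport
reading on `W`; run A's convergence binders). -/
theorem outA_eq_re_newTerm {act : ℕ → ℝ → OpDatum E → Hist → Finset (SCube R) → ℂ}
    (hact : ∀ k s o h Z, act k s o h (footprint Z) = activity (b13InnerData R) S.act k o h Z)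
    (hT : (assembly S).TransportReads Set.univ) {W : Set (ℕ → ℝ)}
    (hsum : ∀ g ∈ W, ∀ (U : R.carriers.BgB) (X : R.carriers.Dom), LevelSummable S X (inputA_KP S E₀ cB g U X))
    (hK : ∀ g ∈ W, ∀ (U : R.carriers.BgB) (X : R.carriers.Dom), ClusAbsConv S X (inputA_KP S E₀ cB g U X))
    (s : ℝ) {g : ℕ → ℝ} (hg : g ∈ W) (U : R.carriers.BgB) (X : R.carriers.Dom) :
    outA S E₀ cB g (R.carriers.transport U) X =
      ((cubeChart R).geom.newTerm act (R.carriers.scale X) s ((step S E₀ cB).opA g U (R.carriers.scale X)) X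
        ((step S E₀ cB).insA g U (R.carriers.scale X) (tableA (outA_KP S E₀ cB) g U))).re := by
  have hTW : (assembly S).TransportReads W := fun g _ U U' h => hT g (Set.mem_univ g) U U' h
  rw [← outA_KP_eq_outA S E₀ cB hTW hsum hK hg U X]
  exact outA_KP_eq_re_newTerm E₀ cB hact hT s g U X

end Summit.QuantumFields.BalabanUV.T4Continuum.U3PolymerDictionaryRecord

end
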